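import Summits.RiemannHypothesis.RiemannHypothesis.Theses.SignCone
import Literature.NumberTheory.LFunctions.WeilExplicit

/-!
# Crux idea sketch (ideator 3, round 1) for `SignCone.OscSingleWindow` (stmt-RiemannHypothesis-18012):
# the ONE-OCTAVE INTEGER CERTIFICATE

First-lemma sheet for the idea card `one-octave-integer-certificate`. Statements only (`def … : Prop`),
no proofs, no `sorry`. All constants are explicit elementary integrals; `bw` is Bombieri's weight
(the `w` of the landed `SignConeFarField_of`, zero at `t_w = log(plastic number) = 0.28120`).

Dictionary: `A = Re F(0)`, `s x = Re F(x) + Re F(-x)`, `F̂(ξ) = weilMellin F (1/2 + iξ)` (≥ 0 on the cone).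
-/

noncomputable section

set_option linter.dupNamespace false

open scoped BigOperators
open MeasureTheory Set

namespace Summit.RiemannHypothesis.RiemannHypothesis.Cruxes.OscSingleWindow.IdeaSketch3

open Literature.NumberTheory.LFunctions

/-- Bombieri's (plastic) weight `w(x) = e^{-x/2} + e^{x/2} - e^{x/2}/(2 sinh x)`; `w < 0` on `(0, t_w)`,
`w > 0` on `(t_w, ∞)`, `w(x) = e^{x/2} - O(e^{-5x/2})`. -/
def bw (x : ℝ) : ℝ := Real.exp (-(x / 2)) + Real.exp (x / 2) - Real.exp (x / 2) / (2 * Real.sinh x)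

/-- The budget constant `c₀ = 1 + log 3 - (log 4π + γ) + ∫₀^{log 2} (1/sinh x - 2|w(x)|) dx = 0.23727…`
(the exact margin of the far-field bookkeeping; the landed proof certifies `≥ 0.196` with rational cells). -/
def budgetConst : ℝ :=
  1 + Real.log 3 - (Real.log (4 * Real.pi) + Real.eulerMascheroniConstant) +
    ∫ x in Ioo (0 : ℝ) (Real.log 2), (1 / Real.sinh x - 2 * |bw x|)

/-- Near-field budget transform `N̂(ξ) = ∫₀^{log 2} (2|w(x)| + 2 w(x) cos(ξ x)) dx` = Fourier transform of the
positive-definite near-field measures `|w|(2δ₀ ∓ (δ_x + δ_{-x}))`; `N̂(0) = 1.213`, `min (c₀ + N̂) = 0.52` at `ξ ≈ 5`,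
`N̂(ξ) = log ξ - 1.076 + O(1/ξ)`. -/
def nearBudget (ξ : ℝ) : ℝ :=
  ∫ x in Ioo (0 : ℝ) (Real.log 2), (2 * |bw x| + 2 * bw x * Real.cos (ξ * x))

/-- Window transform `Ŵ_X(ξ) = ∫_{log X}^{log 2X} w(x) 2cos(ξ x) dx` (the polar+arch weight of ONE octave). -/
def windowHat (X ξ : ℝ) : ℝ :=
  ∫ x in Ioo (Real.log X) (Real.log X + Real.log 2), bw x * (2 * Real.cos (ξ * x))

/-- Trapezoid node weights on the octave `[X, 2X]`: `1` inside, `1/2 + overhang` at the two end nodes. -/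
def trapWeight (X : ℝ) (n : ℕ) : ℝ :=
  if (n : ℝ) < X ∨ 2 * X < (n : ℝ) then 0
  else if n = ⌈X⌉₊ then 1 / 2 + ((⌈X⌉₊ : ℝ) - X)
  else if n = ⌊2 * X⌋₊ then 1 / 2 + (2 * X - (⌊2 * X⌋₊ : ℝ))
  else 1

/-- The integer comb of one octave: `Σ_{X ≤ n ≤ 2X} c_n n^{-1/2} 2cos(ξ log n)` = `2 Re Σ' n^{-1/2+iξ}`. -/
def combHat (X ξ : ℝ) : ℝ :=
  ∑ n ∈ Finset.Icc ⌈X⌉₊ ⌊2 * X⌋₊,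
    trapWeight X n / Real.sqrt (n : ℝ) * (2 * Real.cos (ξ * Real.log (n : ℝ)))

/-- **The one-octave integer certificate at height `X = e^T`**: the explicit real inequality
`c₀ + N̂(ξ) + Ŵ_X(ξ) - comb_X(ξ) ≥ 0` for all `ξ` (even in `ξ`).  `Ŵ_X - comb_X = -2 Re D_X + O(X^{-1/2})`,
`D_X(ξ) = Σ'_{X≤n≤2X} n^{-1/2+iξ} - ∫_X^{2X} x^{-1/2+iξ} dx` (fluctuation of the dyadic zeta sum). -/
def OctaveCertificate (X : ℝ) : Prop :=
  ∀ ξ : ℝ, 0 ≤ budgetConst + nearBudget ξ + windowHat X ξ - combHat X ξ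

/-- **First lemma (budget identity ★)**, a corollary of the landed `stub_bombieriReal` + splitting at `log 2`:
`Re W_ar(F) + A = c₀ A + ∫₀^{log 2} (2A|w| + s w) + ∫_{log 2}^∞ s w`.  Both near-field summands pair `F` with
positive-definite measures, the far integrand is the one dropped outside the window. Verified numerically to 6e-9. -/
def BudgetIdentity : Prop :=
  ∀ F : ℝ → ℂ, IsWeilTest F →
    (weilPolarTerm F + weilArchTerm F).re + (F 0).re =
      budgetConst * (F 0).re +
        (∫ x in Ioo (0 : ℝ) (Real.log 2), (2 * (F 0).re * |bw x| + ((F x).re + (F (-x)).re) * bw x)) +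
        ∫ x in Ioi (Real.log 2), ((F x).re + (F (-x)).re) * bw x

/-- **Near-field positivity in transform form**: for an autocorrelation sum `F`, the near-field term of (★)
is `(1/2π) ∫ F̂(ξ) N̂(ξ) dξ` (Plancherel for the p.d. measures `|w|(2δ₀ ∓ (δ_x+δ_{-x}))`). -/
def NearFieldPlancherel : Prop :=
  ∀ (k : ℕ) (g : Fin k → ℝ → ℂ), (∀ i, IsWeilTest (g i)) →
    let F : ℝ → ℂ := fun t => ∑ i, weilConv (g i) (weilReflect (g i)) t
    (∫ x in Ioo (0 : ℝ) (Real.log 2), (2 * (F 0).re * |bw x| + ((F x).re + (F (-x)).re) * bw x)) =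
      1 / (2 * Real.pi) * ∫ ξ : ℝ, (weilMellin F (1 / 2 + ξ * Complex.I)).re * nearBudget ξ

/-- **Window pairing (Euler–Maclaurin / Poisson on ONE octave)**: the window integral equals the non-negative
node sum plus the pairing of `F̂` with the explicit fluctuation `Ŵ_X - comb_X`. -/
def WindowPairing (X : ℝ) : Prop :=
  ∀ (k : ℕ) (g : Fin k → ℝ → ℂ), (∀ i, IsWeilTest (g i)) →
    let F : ℝ → ℂ := fun t => ∑ i, weilConv (g i) (weilReflect (g i)) t
    (∫ x in Ioo (Real.log X) (Real.log X + Real.log 2), ((F x).re + (F (-x)).re) * bw x) =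
      (∑ n ∈ Finset.Icc ⌈X⌉₊ ⌊2 * X⌋₊,
          trapWeight X n / Real.sqrt (n : ℝ) * ((F (Real.log (n : ℝ))).re + (F (-Real.log (n : ℝ))).re)) +
        1 / (2 * Real.pi) * ∫ ξ : ℝ, (weilMellin F (1 / 2 + ξ * Complex.I)).re * (windowHat X ξ - combHat X ξ)

/-- **Sufficiency (the composition core of the line)**: the certificate on `[20, X₁]` proves the crux for every
cutoff `a` and every test whose far-field negativity sits in a window `[T, T + log 2]` with `3 ≤ T ≤ log X₁`
(here `X = e^T`; nothing depends on `a`).  With `X₁ = ∞` this is the crux `OscSingleWindow` verbatim (Literature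
vocabulary, `Iff.rfl`-equal to the item per the route's CONE NOTE); the card's honest range is `X₁ < ∞`. -/
def OctaveCertificateSuffices (X₁ : ℝ) : Prop :=
  (∀ X : ℝ, 20 ≤ X → X ≤ X₁ → OctaveCertificate X) →
    ∀ a : ℝ, 0 < a → ∀ (k : ℕ) (g : Fin k → ℝ → ℂ),
      (∀ i, IsWeilTest (g i) ∧ tsupport (g i) ⊆ Set.Icc (-a) a) →
      let F : ℝ → ℂ := fun t => ∑ i, weilConv (g i) (weilReflect (g i)) t
      (∀ n : ℕ, 2 ≤ n → 0 ≤ (F (Real.log n)).re) →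
      (∃ T : ℝ, 3 ≤ T ∧ Real.exp T ≤ X₁ ∧
          ∀ t : ℝ, Real.log 2 ≤ |t| → (F t).re < 0 → T ≤ |t| ∧ |t| ≤ T + Real.log 2) →
      -(F 0).re ≤ (weilPolarTerm F + weilArchTerm F).re

/-- Shape check: the `X₁`-free sufficiency statement implies the route item (modulo the defeq of vocabularies,
left to the skeleton; stated here only as a Prop to fix the logical shape). -/
def LineShape : Prop :=
  (∀ X₁ : ℝ, OctaveCertificateSuffices X₁) → (∀ X : ℝ, 20 ≤ X → OctaveCertificate X) →
    Summit.RiemannHypothesis.RiemannHypothesis.Theses.SignCone.OscSingleWindow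

end Summit.RiemannHypothesis.RiemannHypothesis.Cruxes.OscSingleWindow.IdeaSketch3

end
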